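import Summits.Ventures.CertifiedArithmetic.Expansions.CompressValuationSweeps
import Summits.Ventures.CertifiedArithmetic.Expansions.CompressFixedPointIff
import Mathlib.Tactic.Linarith
import Mathlib.Tactic.Positivity
import Mathlib.Tactic.Ring
import Mathlib.Tactic.NormNum

/-!
# COMPRESS TERMINATES: every list-changing pass lowers the potential (new work)

New work of the certified-arithmetic venture (ENGINES group: shared numerical engines serving
client cells; rigour lives in the verifiers; every published number belongs to a client cell's
ledger, not to the engines group).  [Shewchuk1997, Thm 23] describes ONE pass of COMPRESS (§2.7,
Fig. 11) and does not claim idempotence; the venture showed that a pass need not reach the fixed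
point (`CompressNotIdempotent*.lean`) and that the number of list-changing passes is unbounded
(`CompressPassesUnbounded*.lean`).  This file closes the question from above:

* `valPot_compress_lt` — for a NONADJACENT expansion `e` of nonzero floats (the shape of every
  COMPRESS output under ties-to-even, Thm 23) and any round-to-nearest whose roundoffs lie 2-below
  the rounded sums (`RoundoffBelow 2`, e.g. `roundTiesEven`), `p ≥ 2`:
  `compress e ≠ e → valPot emin (compress e) < valPot emin e`, where
  `valPot emin l = Σ_{x ∈ l} (v x − emin) ≥ 0` (`v` the 2-adic valuation);
* `compress_iterate_fixed` — hence for EVERY nonoverlapping expansion `e` of floats the iterates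
  `compress^[n] e` are constant from some `N ≤ valPot emin (compress e) + 2` on
  (`compress_iterate_eventually_const`), in particular under `roundTiesEven`
  (`compress_iterate_fixed_roundTiesEven`); a priori, on a nonadjacent expansion of `n` nonzero
  floats of magnitude at most `2^M` the iterates are fixed after at most `n · (M − emin) + 1`
  passes (`compress_iterate_fixed_of_abs_le`); and the iterate so reached is a CHAIN — the
  venture's characterisation of the fixed points of COMPRESS, `CompressFixedPointIff.lean`
  (`compress_iterate_isChain`).

The proof assembles the two sweeps (`compressDown_valPot`, `compressUp_valPot`) on top of the
tree's one-pass analysis `compressDown_spec` / `compress_spec`.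

References: J. R. Shewchuk, Discrete Comput. Geom. 18 (1997) 305–363, §2.7 and Thm 23
[Shewchuk1997]; S. Boldo, C.-P. Jeannerod, G. Melquiond, J.-M. Muller, Acta Numerica 32 (2023),
§2.1–2.2 [BoldoEtAl2023].
-/

namespace Summit.Ventures.CertifiedArithmetic.Expansions

open Literature.ComputerArithmetic.JeannerodRump2018
open Literature.ComputerArithmetic.BoldoJeannerodMelquiondMuller2023 hiding twoSum twoSum_fst
open Literature.ComputerArithmetic.Shewchuk1997

variable {p : ℕ} {emin : ℤ} {fl : ℚ → ℚ}

/-! ### One pass -/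

/-- **EVERY LIST-CHANGING PASS OF COMPRESS LOWERS THE POTENTIAL** (nonadjacent expansion of
nonzero floats, smallest first; any round-to-nearest with roundoffs 2-below the rounded sums,
`p ≥ 2`). [cite: Shewchuk1997, §2.7 p. 332 (COMPRESS), Thm 23 p. 331–333] -/
theorem valPot_compress_lt (hp : 2 ≤ p) (hfl : IsRoundNearest p emin fl)
    (hfl2 : RoundoffBelow 2 fl) {e : List ℚ} (he : ∀ x ∈ e, IsFloat p emin x)
    (hne : ∀ x ∈ e, x ≠ 0) (hexp : IsExpansion 2 e) (hch : compress fl e ≠ e) :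
    valPot emin (compress fl e) < valPot emin e := by
  cases hrev : e.reverse with
  | nil =>
    have he0 : e = [] := by simpa using congrArg List.reverse hrev
    subst he0
    exact absurd (by simp [compress]) hch
  | cons em rest =>
    have he' : e = rest.reverse ++ [em] := by simpa using congrArg List.reverse hrev
    have hcomp : compress fl e =
        compressUp fl (compressDown fl em rest).2 (compressDown fl em rest).1.reverse := by
      simp only [compress, hrev]
    rw [hcomp] at hch ⊢
    subst he'
    have hem : IsFloat p emin em := he em (by simp)
    have hem0 : em ≠ 0 := hne em (by simp)
    have hrestF : ∀ y ∈ rest, IsFloat p emin y := fun y hy => he y (by simp [hy])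
    have hrestne : ∀ y ∈ rest, y ≠ 0 := fun y hy => hne y (by simp [hy])
    have hpw2 := List.pairwise_append.mp hexp
    have hpw : rest.Pairwise (fun a b => Below 2 b a) := List.pairwise_reverse.mp hpw2.1
    have hbel : ∀ y ∈ rest, Below 2 y em := fun y hy =>
      hpw2.2.2 y (List.mem_reverse.mpr hy) em (by simp)
    have hexp1 : IsExpansion 1 rest.reverse := IsExpansion.anti hpw2.1 (by norm_num)
    have hbel1 : ∀ y ∈ rest, Below 1 y em := fun y hy => (hbel y hy).anti (by norm_num)
    -- the tree's one-pass facts and the valuation facts of the downward sweep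
    have outd := compressDown_spec hp hfl rest em hem hrestF hexp1 hbel1
    have outv := compressDown_valPot hp hfl hfl2 rest em hem hem0 hrestF hrestne hpw
      (fun y hy => hbel y (List.mem_of_mem_head? hy))
    generalize hgs : (compressDown fl em rest).1 = gs at *
    generalize hgb : (compressDown fl em rest).2 = gb at *
    have hgb0 : gb ≠ 0 := outv.ne gb (by simp)
    have inv : UpInv p emin 2 [] gb :=
      ⟨by simp, outd.hgb, List.Pairwise.nil, by simp, by simp, by simpa using ulp_pos _⟩
    have hst : UStair p emin (gb + ([] : List ℚ).sum) gs.reverse := by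
      have h := uStair_reverse_of_dStair outd.stair
      rw [List.reverse_append, List.reverse_singleton, List.singleton_append, uStair_cons,
        zero_add] at h
      simpa using h.2
    have hch0 := List.isChain_reverse.mpr outd.chain
    rw [List.reverse_append, List.reverse_singleton, List.singleton_append,
      List.isChain_cons] at hch0
    have hslack : UpSlack p emin (padicValRat 2 gb) (gb + ([] : List ℚ).sum) gs.reverse := by
      rw [List.sum_nil, add_zero]; exact upSlack_of_downSlack gb gs outv.slack
    have outu := compressUp_valPot hp hfl hfl2 gs.reverse gb [] inv hgb0
      (fun g hg => outd.floats g (List.mem_reverse.mp hg))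
      (fun g hg => outd.big g (List.mem_reverse.mp hg)) hst hch0.2 hch0.1 hslack
    have hpot_e : valPot emin (rest.reverse ++ [em]) = valPot emin (em :: rest) := by
      rw [valPot_append, valPot_reverse, valPot_cons, valPot_cons, valPot_nil]; ring
    have hpot_d : valPot emin (gb :: gs.reverse) = valPot emin (gs ++ [gb]) := by
      rw [← valPot_reverse emin (gs ++ [gb]), List.reverse_append, List.reverse_singleton,
        List.singleton_append]
    rcases outu with hu | hu
    · rw [hpot_d] at hu
      rcases outv.pot with hd | hd
      · rw [hpot_e]; omega
      · rw [hpot_e, ← hd]; exact hu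
    · rcases outv.pot with hd | hd
      · rw [hu, hpot_e, hpot_d]; exact hd
      · exfalso
        apply hch
        rw [hu]
        simpa using congrArg List.reverse hd

/-! ### Iterating COMPRESS -/

/-- COMPRESS of a single component is that component.
[cite: Shewchuk1997, §2.7 p. 332 (COMPRESS)] -/
theorem compress_singleton (fl : ℚ → ℚ) (s : ℚ) : compress fl [s] = [s] := by
  simp [compress]

/-- ONE STEP OF THE DESCENT: a pass from a nonadjacent expansion of nonzero floats either reaches
a fixed point at once, or lands on a nonadjacent expansion of nonzero floats of SMALLER
(nonnegative) potential. [cite: Shewchuk1997, Thm 23 p. 331] -/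
theorem compress_fixed_or_valPot_lt (hp : 2 ≤ p) (hfl : IsRoundNearest p emin fl)
    (hfl2 : RoundoffBelow 2 fl) {l : List ℚ} (hl : ∀ x ∈ l, IsFloat p emin x)
    (hne : ∀ x ∈ l, x ≠ 0) (hexp : IsExpansion 2 l) :
    compress fl (compress fl l) = compress fl l ∨
      ((∀ x ∈ compress fl l, IsFloat p emin x) ∧ (∀ x ∈ compress fl l, x ≠ 0) ∧
        IsExpansion 2 (compress fl l) ∧ 0 ≤ valPot emin (compress fl l) ∧
        valPot emin (compress fl l) < valPot emin l) := by
  by_cases hch : compress fl l = l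
  · left; rw [hch, hch]
  · have out := compress_spec hp hfl (by norm_num : (1 : ℚ) ≤ 2) hfl2 hl (hexp.anti (by norm_num))
    rcases out.nz with hnz | hsingle
    · exact Or.inr ⟨out.floats, hnz, out.exp, valPot_nonneg out.floats hnz,
        valPot_compress_lt hp hfl hfl2 hl hne hexp hch⟩
    · left; rw [hsingle, compress_singleton]

/-- THE DESCENT: from a nonadjacent expansion of nonzero floats of potential `≤ n`, the iterates
of COMPRESS are fixed after at most `n + 1` further passes. [cite: Shewchuk1997, Thm 23 p. 331] -/
theorem compress_iterate_fixed_of_valPot_le (hp : 2 ≤ p) (hfl : IsRoundNearest p emin fl)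
    (hfl2 : RoundoffBelow 2 fl) :
    ∀ (n : ℕ) (l : List ℚ), (∀ x ∈ l, IsFloat p emin x) → (∀ x ∈ l, x ≠ 0) →
      IsExpansion 2 l → valPot emin l ≤ n →
      ∃ N : ℕ, N ≤ n + 1 ∧ (compress fl)^[N + 1] l = (compress fl)^[N] l := by
  intro n
  induction n with
  | zero =>
    intro l hl hne hexp hn
    rcases compress_fixed_or_valPot_lt hp hfl hfl2 hl hne hexp with h | h
    · exact ⟨1, le_rfl, by simpa using h⟩
    · exfalso
      have h1 := h.2.2.2.1
      have h2 := h.2.2.2.2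
      push_cast at hn
      omega
  | succ m ih =>
    intro l hl hne hexp hn
    rcases compress_fixed_or_valPot_lt hp hfl hfl2 hl hne hexp with h | h
    · exact ⟨1, by omega, by simpa using h⟩
    · obtain ⟨hF, hnz, hexp', -, hlt⟩ := h
      obtain ⟨N, hN, hfix⟩ := ih (compress fl l) hF hnz hexp' (by push_cast at hn ⊢; omega)
      refine ⟨N + 1, by omega, ?_⟩
      rw [Function.iterate_succ_apply, Function.iterate_succ_apply (compress fl) N l]
      exact hfix

/-- A-PRIORI BOUND ON THE POTENTIAL: `n` nonzero floats of magnitude at most `2^M` have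
potential at most `n · (M − emin)`. [cite: BoldoEtAl2023, §2.1 (floating-point data)] -/
theorem valPot_le_length_mul {l : List ℚ} (hl : ∀ x ∈ l, IsFloat p emin x)
    (hne : ∀ x ∈ l, x ≠ 0) {M : ℤ} (hM : ∀ x ∈ l, |x| ≤ (2 : ℚ) ^ M) :
    valPot emin l ≤ l.length * (M - emin) := by
  induction l with
  | nil => simp
  | cons x l ih =>
    rw [valPot_cons, List.length_cons]
    have h1 := padicValRat_two_le_of_abs_le (OnGrid.of_isFloat (hl x (by simp))) (hne x (by simp))
      (hM x (by simp))
    have h2 := ih (fun y hy => hl y (List.mem_cons_of_mem _ hy))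
      (fun y hy => hne y (List.mem_cons_of_mem _ hy)) (fun y hy => hM y (List.mem_cons_of_mem _ hy))
    have h3 : ((l.length + 1 : ℕ) : ℤ) * (M - emin) = (l.length : ℤ) * (M - emin) + (M - emin) := by
      push_cast; ring
    rw [h3]
    omega

/-- **A-PRIORI BOUND.** On a nonadjacent expansion of `n` nonzero floats of magnitude at most
`2^M` — the shape of every COMPRESS output (Thm 23) — the iterates of COMPRESS are fixed after at
most `n · (M − emin) + 1` passes. [cite: Shewchuk1997, §2.7 p. 332 (COMPRESS), Thm 23 p. 331] -/
theorem compress_iterate_fixed_of_abs_le (hp : 2 ≤ p) (hfl : IsRoundNearest p emin fl)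
    (hfl2 : RoundoffBelow 2 fl) {l : List ℚ} (hl : ∀ x ∈ l, IsFloat p emin x)
    (hne : ∀ x ∈ l, x ≠ 0) (hexp : IsExpansion 2 l) {M : ℤ} (hM : ∀ x ∈ l, |x| ≤ (2 : ℚ) ^ M) :
    ∃ N : ℕ, N ≤ (l.length * (M - emin)).toNat + 1 ∧
      (compress fl)^[N + 1] l = (compress fl)^[N] l :=
  compress_iterate_fixed_of_valPot_le hp hfl hfl2 _ l hl hne hexp
    ((valPot_le_length_mul hl hne hM).trans (Int.self_le_toNat _))

/-- **ITERATED COMPRESS REACHES ITS FIXED POINT** (any nonoverlapping expansion of floats,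
smallest first, zero components allowed; any round-to-nearest with roundoffs 2-below the rounded
sums, `p ≥ 2`): the iterates are fixed after at most `valPot emin (compress e) + 2` passes.
[cite: Shewchuk1997, §2.7 p. 332 (COMPRESS), Thm 23 p. 331] -/
theorem compress_iterate_fixed (hp : 2 ≤ p) (hfl : IsRoundNearest p emin fl)
    (hfl2 : RoundoffBelow 2 fl) {e : List ℚ} (he : ∀ x ∈ e, IsFloat p emin x)
    (hexp : IsExpansion 1 e) :
    ∃ N : ℕ, N ≤ (valPot emin (compress fl e)).toNat + 2 ∧
      (compress fl)^[N + 1] e = (compress fl)^[N] e := by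
  have out := compress_spec hp hfl (by norm_num : (1 : ℚ) ≤ 2) hfl2 he hexp
  rcases out.nz with hnz | hsingle
  · obtain ⟨N, hN, hfix⟩ := compress_iterate_fixed_of_valPot_le hp hfl hfl2
      (valPot emin (compress fl e)).toNat (compress fl e) out.floats hnz out.exp
      (Int.self_le_toNat _)
    refine ⟨N + 1, by omega, ?_⟩
    rw [Function.iterate_succ_apply, Function.iterate_succ_apply (compress fl) N e]
    exact hfix
  · refine ⟨1, by omega, ?_⟩
    rw [Function.iterate_succ_apply, Function.iterate_one, hsingle, compress_singleton]

/-- Once fixed, fixed forever: the iterates are EVENTUALLY CONSTANT, from an index at most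
`valPot emin (compress e) + 2`. [cite: Shewchuk1997, §2.7 p. 332 (COMPRESS)] -/
theorem compress_iterate_eventually_const (hp : 2 ≤ p) (hfl : IsRoundNearest p emin fl)
    (hfl2 : RoundoffBelow 2 fl) {e : List ℚ} (he : ∀ x ∈ e, IsFloat p emin x)
    (hexp : IsExpansion 1 e) :
    ∃ N : ℕ, N ≤ (valPot emin (compress fl e)).toNat + 2 ∧
      ∀ n, N ≤ n → (compress fl)^[n] e = (compress fl)^[N] e := by
  obtain ⟨N, hN, hfix⟩ := compress_iterate_fixed hp hfl hfl2 he hexp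
  rw [Function.iterate_succ_apply'] at hfix
  refine ⟨N, hN, fun n hn => ?_⟩
  obtain ⟨m, rfl⟩ := Nat.exists_eq_add_of_le hn
  induction m with
  | zero => rfl
  | succ m ih => rw [← add_assoc, Function.iterate_succ_apply', ih (by omega), hfix]

/-- The iterates of COMPRESS stay nonoverlapping expansions of floats (Theorem 23, any tie
rule). [cite: Shewchuk1997, Thm 23 p. 331] -/
theorem compress_iterate_floats_isExpansion (hp : 2 ≤ p) (hfl : IsRoundNearest p emin fl)
    {e : List ℚ} (he : ∀ x ∈ e, IsFloat p emin x) (hexp : IsExpansion 1 e) :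
    ∀ n : ℕ, (∀ x ∈ (compress fl)^[n] e, IsFloat p emin x) ∧
      IsExpansion 1 ((compress fl)^[n] e) := by
  intro n
  induction n with
  | zero => exact ⟨he, hexp⟩
  | succ n ih =>
    rw [Function.iterate_succ_apply']
    have out := compress_nonoverlapping hp hfl ih.1 ih.2
    exact ⟨out.floats, out.exp⟩

/-- **ITERATED COMPRESS REACHES A CHAIN**: combining the descent with the venture's
characterisation of the fixed points of COMPRESS (`compress_eq_self_iff_isChain`: fixed points =
CHAINS, every component a nonzero float absorbed by the next, `fl (eᵢ₊₁ + eᵢ) = eᵢ₊₁`), the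
iterate reached after at most `valPot emin (compress e) + 2` passes is a chain and stays put.
[cite: Shewchuk1997, §2.7 p. 332 (COMPRESS), Thm 23 p. 331–333] -/
theorem compress_iterate_isChain (hp : 2 ≤ p) (hfl : IsRoundNearest p emin fl)
    (hfl2 : RoundoffBelow 2 fl) {e : List ℚ} (he : ∀ x ∈ e, IsFloat p emin x)
    (hexp : IsExpansion 1 e) :
    ∃ N : ℕ, N ≤ (valPot emin (compress fl e)).toNat + 2 ∧
      (compress fl)^[N + 1] e = (compress fl)^[N] e ∧
      List.IsChain (fun a b => fl (b + a) = b ∧ fl a = a ∧ a ≠ 0) ((compress fl)^[N] e) := by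
  obtain ⟨N, hN, hfix⟩ := compress_iterate_fixed hp hfl hfl2 he hexp
  have hF := compress_iterate_floats_isExpansion hp hfl he hexp N
  refine ⟨N, hN, hfix, (compress_eq_self_iff_isChain hp hfl hF.1 hF.2).mp ?_⟩
  rw [Function.iterate_succ_apply'] at hfix
  exact hfix

/-- **ITERATED COMPRESS TERMINATES UNDER TIES-TO-EVEN** (the paper's arithmetic; `p ≥ 2`, any
nonoverlapping expansion of floats). [cite: Shewchuk1997, §2.7 p. 332 (COMPRESS), Thm 23 p. 331;
BoldoEtAl2023, §2.2 (ties-to-even)] -/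
theorem compress_iterate_fixed_roundTiesEven (hp : 2 ≤ p) {e : List ℚ}
    (he : ∀ x ∈ e, IsFloat p emin x) (hexp : IsExpansion 1 e) :
    ∃ N : ℕ, N ≤ (valPot emin (compress (roundTiesEven p emin) e)).toNat + 2 ∧
      (compress (roundTiesEven p emin))^[N + 1] e = (compress (roundTiesEven p emin))^[N] e :=
  compress_iterate_fixed hp (isRoundNearest_roundTiesEven (le_trans (by norm_num) hp))
    (roundoffBelow_two_roundTiesEven p emin) he hexp

/-- The potential drop, specialised to ties-to-even: every list-changing pass of COMPRESS applied
to a nonadjacent expansion of nonzero floats lowers `valPot`. [cite: Shewchuk1997, Thm 23 p. 331;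
BoldoEtAl2023, §2.2 (ties-to-even)] -/
theorem valPot_compress_lt_roundTiesEven (hp : 2 ≤ p) {e : List ℚ}
    (he : ∀ x ∈ e, IsFloat p emin x) (hne : ∀ x ∈ e, x ≠ 0) (hexp : IsExpansion 2 e)
    (hch : compress (roundTiesEven p emin) e ≠ e) :
    valPot emin (compress (roundTiesEven p emin) e) < valPot emin e :=
  valPot_compress_lt hp (isRoundNearest_roundTiesEven (le_trans (by norm_num) hp))
    (roundoffBelow_two_roundTiesEven p emin) he hne hexp hch

end Summit.Ventures.CertifiedArithmetic.Expansions
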